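import Summits.Parity.BatemanHorn.Theorems.RoughValueTransportDefs
import Summits.Parity.BatemanHorn.Theorems.RoughValueTransportBalancedSemiprimeLayerQuadraticDictionary
import Summits.Parity.BatemanHorn.Theorems.RoughValueTransportBalancedSemiprimeLayerLinearLayer
import Summits.Parity.BatemanHorn.Theorems.RoughValueTransportBalancedSemiprimeLayerUniformTypeI
import Summits.Parity.BatemanHorn.Theorems.RoughValueTransportBalancedSemiprimeLayerTwistedHooley
import Summits.Parity.BatemanHorn.Theorems.RoughValueTransportBalancedSemiprimeLayerQuadraticSieve
import Summits.Parity.BatemanHorn.Theses.RoughValueTransport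
import Summits.Parity.BatemanHorn.Theorems.BalancedSemiprimeLayer.Negative.NatDegreePos
import Summits.Parity.BatemanHorn.Theorems.BalancedSemiprimeLayer.Negative.Structure

/-!
# Line `smooth-modulus-twisted-hooley` — checked skeleton for crux `BalancedSemiprimeLayer`
(item stmt-Parity-9469, route `RoughValueTransport`, sub-problem `BatemanHorn`)
— LEAD'S RESHAPE r1, integration 5 (prover-line-stmt-Parity-9469-0, 2026-08-16): ALL working stubs LANDED; only the open residual `stub_higherLayer` is sorried

Crux (by name, concluded by `BalancedSemiprimeLayer_of` below, from `balancedSemiprimeLayer_of_parts`):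
`Summit.Parity.BatemanHorn.Theses.RoughValueTransport.BalancedSemiprimeLayer` — for every
Bateman–Horn system `f` of `k` polynomials and every `ε > 0` there is `δ ∈ (0, 1/4]` with, eventually
in `x`, `Φ_f(x, δ) ≤ P_f(x) + ε·x/(log x)^k`, where `Φ_f(x, δ)` counts the `1 ≤ n ≤ x` all of whose
values `fᵢ(n)` are positive and free of primes `< x^{deg fᵢ (1−δ)/2}` (jointly rough) and
`P_f = polyPrimeCount f`.

## The line (idea card `Ideas/smooth-modulus-twisted-hooley.md`, planner skeleton commit a0a8ea2b35d1,
merged per triage with `rough-relaxed-divisor-sieve`; triage TRIAGE-r1-{1,2,3}.md all pass)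

Union bound over coordinates KEEPING THE OTHER COORDINATES ROUGH (the naive coordinatewise bound is
refuted: `Negative.not_cruxCoordinatewise`), then by the degree of the coordinate:

* `stub_linearLayer` — a linear coordinate: the balanced prime `p₁ ≤ √(a x + b)` is an individual
  modulus of a progression of length `≥ √x`; relax the cofactor's primality and the spectators'
  roughness to `x^c`-roughness and apply the `k`-dimensional upper-bound sieve
  (`SieveSequence.fundamental_lemma_uniform_holds`, PROVED; template `polyPrimeCount_le_brunSieve_holds`
  + `polyAPSeq`) — Type-I is trivial (moduli `< x^{0.7}`); `∑ 1/p₁ ≈ log((1+δ)/(1−δ))` by the PROVED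
  Mertens window sums (`sum_inv_primes_window_le`, `abs_primeRecipSum_sub_le`).
* `stub_twistedHooley` — THE LEVER (the only input beyond level `x`): a Hooley-1963-type power
  saving for the root Weyl sums of the DILATES `Q²X² − Δ` of the discriminant form of an
  irreducible quadratic, over moduli `m ≤ M` in a class `m ≡ u (mod Q)`, `(m, Q) = 1`, losses
  polynomial in `Q, h`.  Rung `Q = 1` is the PROVED `hooley1963_quadraticRoots_allModuli_logSqSaving_holds`.
* `stub_uniformTypeI` — from the lever to plain Type-I information for the congruence counts of
  the quadratic `g` in progressions, UNIFORMLY (polynomially) in the progression modulus — the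
  uniform version of the PROVED `TypeIFromWeyl.typeI_of_weylLevelBound`.
* `stub_quadraticDictionary` (reshape r1, elementary) — a quadratic coordinate's layer injects
  (`n ↦ (n, minFac fᵢ(n))`, up to the `≤ 2` roots of `fᵢ − 1`) into the relaxed sifted divisor
  family `pairFamily f i δ c x` (window `m ∈ [x^{1−δ}, x^{1+δ}]`, `m ∣ fᵢ(n)`, `(m, B) = 1`, all
  `fⱼ(n)` `x^c`-rough): BOTH balanced primes relaxed — legal because the crux is an UPPER bound.
* `stub_quadraticSieve` (reshape r1, the sieve half) — `UniformTypeI (f i)` ⇒ the relaxed family is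
  thin: `#pairFamily ≤ ε x/(log x)^k` for all `δ ≤ δ₀(ε)` (dimension-`(k+1)` fundamental lemma on
  the pairs sifted by `p ∣ m·∏ⱼ fⱼ(n)`; `δ` survives only as the main-term factor
  `∑_{m ∈ window} ρ(m)/m ≍ 2δ log x`, PROVED `RhoLogSums.abs_rhoLogSum_sub_le`; remainder = `UniformTypeI`).
* `stub_higherLayer` — coordinates of degree `≥ 3`: the HONEST OPEN RESIDUAL of the crux (balanced
  factors `p₁ ~ x^{d(1−δ)/2} > x` = number of terms; `Literature.Barriers.Parity.FordMaynardLowLevel`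
  applies).  Registered so that the composition is honest; verbatim the route's foreseen split item
  `LayerHigher` (TWO-LAYER PLAN) in coordinate form.  STUCK/open from cycle 1 (promote-stub candidate).
* `stub_coordLayerMono` — bookkeeping (monotonicity of `E_{f,i}(x,δ)` in `δ`, used by the
  composition); registered so that the line's VOCABULARY file `Theorems/RoughValueTransportDefs.lean`
  (which proves it) can land as a `--supports` file — the registered stubs can only land under
  `Theorems/` once their vocabulary is importable from there.

Scope: the stubs other than `stub_higherLayer` close the crux for EVERY Bateman–Horn system all of
whose coordinates have degree `≤ 2`, and the linear/quadratic coordinates of any system.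

Disproof used (`Cruxes/BalancedSemiprimeLayer/Disproof.lean`, gen 2 rev 5; landed copies under
`Theorems/BalancedSemiprimeLayer/Negative/`): `not_cruxCoordinatewise` (spectators stay rough in
`coordLayer`), `_false_without_noFixedPrimeDivisor` (used in `stub_linearLayer`/`stub_quadraticSieve`:
`ω_F(p) < p` ⇔ sieve density `g(p) < 1`), `_false_without_irreducible` (used in `stub_twistedHooley`:
`Δ` non-square ⇔ `ρ` well defined and Hooley applies; and in `stub_quadraticDictionary`: `fᵢ − 1 ≠ 0`),
`_false_without_notAssociated` (the `k+1` sieve dimensions are distinct polynomials),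
`two_mul_delta_le_of_eventually_cruxIneq_X` (every stub outputs `E ≪_f δ·x/(log x)^k`: `δ(ε)` linear in
`ε`, `f`-dependent — consistent), refuted strengthenings (no stub claims a `(log x)^{-(k+1)}` tolerance
or a uniform `δ`); `§8 Targets`: none yet. Imported here: `natDegree_pos_of_isBatemanHornSystem`,
`balancedSemiprimeLayer_iff_pos`.

`lean check`: rc 0, `sorry` ONLY inside `stub_higherLayer` (coordLayerMono p72142, quadraticDictionary p72470,
linearLayer p73627, uniformTypeI p74271, twistedHooley p74670/p74417 and quadraticSieve p74679…p76614 are LANDED and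
imported; the composition `stub_transfer` + `layerConclusion_of_natDegree_le_two` +
`balancedSemiprimeLayer_iff_higherLayer` also land separately as `Theorems/…DegreeLeTwo.lean`, p78616); `balancedSemiprimeLayer_of_parts`
(hypothesis form) is a real proof with clean axioms, and `BalancedSemiprimeLayer_of : BalancedSemiprimeLayer`
feeds it the stubs (the by-name `#h21_check_skeleton` theorem).

VOCABULARY: landed as `Theorems/RoughValueTransportDefs.lean` (p72142) and imported here.
-/

noncomputable section

namespace Summit.Parity.BatemanHorn.Cruxes.BalancedSemiprimeLayer.SmoothModulusTwistedHooley

open Polynomial Filter Finset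
open Literature.NumberTheory.Sieve
open Summit.Parity.BatemanHorn.Theses.RoughValueTransport (BalancedSemiprimeLayer)
open Summit.Parity.BatemanHorn.Theorems.BalancedSemiprimeLayer.Negative
  (natDegree_pos_of_isBatemanHornSystem balancedSemiprimeLayer_iff_pos)
open scoped BigOperators

/-! ### Objects of the line

The vocabulary (`coordLayer`, `CoordLayerThin`, `TwistedHooleyDilates`, `UniformTypeI`, `quadWindow`,
`pairFamily`, `mem_pairFamily`, `coordLayer_mono`) is the LANDED file
`Summits/Parity/BatemanHorn/Theorems/RoughValueTransportDefs.lean` (p72142, accepted 2026-08-16T00:23Z),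
same namespace; it also proves the registered bookkeeping stub `stub_coordLayerMono`.
`stub_quadraticDictionary` is the LANDED file
`Summits/Parity/BatemanHorn/Theorems/RoughValueTransportBalancedSemiprimeLayerQuadraticDictionary.lean`
(p72470, accepted 2026-08-16T00:35Z); `stub_linearLayer` is the LANDED file
`Summits/Parity/BatemanHorn/Theorems/RoughValueTransportBalancedSemiprimeLayerLinearLayer.lean` (p73627);
`stub_uniformTypeI` is the LANDED file `…UniformTypeI.lean` (p74271); `stub_twistedHooley` is the LANDED file
`…TwistedHooley.lean` (p74670, analytic core Literature/NumberTheory/Sieve/QuadraticRootsTwistedHooley.lean p74417);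
`stub_quadraticSieve` is the LANDED chain `…QuadraticSieve{Defs,Sequence,Remainder,Core,Bookkeeping,Height,∅}.lean`
(p74679 p74956 p76053 p76088 p76213 p76354 p76614, a 2003-line `(k+1)`-dimensional sieve by the line's stub worker).
All six are imported above; their `sorry`s are gone from this file. -/

/-! ### The one registered stub still open (`sorry` lives ONLY here) -/

-- `stub_coordLayerMono` : LANDED (RoughValueTransportDefs.lean, p72142).

-- `stub_linearLayer` : LANDED (RoughValueTransportBalancedSemiprimeLayerLinearLayer.lean, p73627; helpers in
-- Literature/NumberTheory/Sieve/LinearPolynomialRoughCompositeValues.lean, p73231).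

-- `stub_twistedHooley` : LANDED (RoughValueTransportBalancedSemiprimeLayerTwistedHooley.lean, p74670; analytic core in
-- Literature/NumberTheory/Sieve/QuadraticRootsTwistedHooley.lean, p74417 — route B of the lead's blueprint).

-- `stub_uniformTypeI` : LANDED (RoughValueTransportBalancedSemiprimeLayerUniformTypeI.lean, p74271; analytic core in
-- Literature/NumberTheory/Sieve/PolynomialCongruencesTypeIUniform.lean, p73867).

-- `stub_quadraticDictionary` : LANDED (RoughValueTransportBalancedSemiprimeLayerQuadraticDictionary.lean, p72470).

/-- **stub_higherLayer** (OPEN — the crux's residual, not moved by this line; STUCK from cycle 1).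
Coordinates of degree `d ≥ 3`: balanced factors `p₁ ~ x^{d(1−δ)/2} ≥ x^{1.1}` exceed the number of
terms, Type-I data below that level cannot distinguish "fᵢ(n) prime" from "fᵢ(n) = p₁p₂ balanced"
among rough values (`Literature.Barriers.Parity.FordMaynardLowLevel`; card Transfer: for `d = 3` the
needed saving `1/3` uniform in `h ≤ M^{1/3}` is two rungs above print, for `d ≥ 4` it is beyond
square-root cancellation).  Registered so that the composition is honest; equals the route's foreseen
split item `LayerHigher` (TWO-LAYER PLAN) in coordinate form (other coordinates kept rough). -/
theorem stub_higherLayer :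
    ∀ (k : ℕ) (f : Fin k → ℤ[X]), IsBatemanHornSystem f →
      ∀ i : Fin k, 3 ≤ (f i).natDegree → CoordLayerThin f i := by
  sorry

/-! ### Glue (proved): the quadratic coordinate from its two parts -/

/-- `ε · x/(log x)^k → ∞` along `ℕ` (`ε > 0`). [ported from `Disproof.tendsto_mul_div_log_pow_atTop`] -/
theorem tendsto_mul_div_log_pow_atTop {ε : ℝ} (hε : 0 < ε) (k : ℕ) :
    Tendsto (fun x : ℕ => ε * x / Real.log x ^ k) atTop atTop := by
  have h1 : Tendsto (fun x : ℝ => Real.log x ^ k / x) atTop (nhds 0) := by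
    simpa using Real.tendsto_pow_log_div_mul_add_atTop 1 0 k one_ne_zero
  have h2 : Tendsto (fun x : ℝ => Real.log x ^ k / x) atTop (nhdsWithin 0 (Set.Ioi 0)) := by
    refine tendsto_nhdsWithin_iff.mpr ⟨h1, ?_⟩
    filter_upwards [eventually_gt_atTop 1] with x hx
    exact div_pos (pow_pos (Real.log_pos hx) k) (by linarith)
  have h3 := (h2.inv_tendsto_nhdsGT_zero).comp tendsto_natCast_atTop_atTop
  have h4 := h3.const_mul_atTop hε
  refine h4.congr' (Eventually.of_forall fun x => ?_)
  simp only [Function.comp_apply, Pi.inv_apply, inv_div]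
  ring

/-- **The quadratic coordinate from the dictionary and the sieve** (hypothesis form, real proof):
given `ε`, take `c` and `δ₀(ε/2)` from the sieve part, `δ := min(δ₀, 1/4)`, and
`E_{f,i}(x, δ) ≤ 2 + #pairFamily ≤ 2 + (ε/2)x/(log x)^k ≤ εx/(log x)^k` eventually. [folklore] -/
theorem coordLayerThin_quadratic_of_parts
    (hdict : ∀ (k : ℕ) (f : Fin k → ℤ[X]), IsBatemanHornSystem f → ∀ i : Fin k, (f i).natDegree = 2 →
      ∀ δ c : ℝ, 0 < δ → δ ≤ 1 / 4 → 0 < c → c ≤ 1 / 4 →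
        ∀ᶠ x : ℕ in atTop, coordLayer f i δ x ≤ 2 + #(pairFamily f i δ c x))
    (hsieve : ∀ (k : ℕ) (f : Fin k → ℤ[X]), IsBatemanHornSystem f → ∀ i : Fin k, (f i).natDegree = 2 →
      UniformTypeI (f i) → ∃ c : ℝ, 0 < c ∧ c ≤ 1 / 4 ∧ ∀ ε : ℝ, 0 < ε → ∃ δ₀ : ℝ, 0 < δ₀ ∧
        ∀ δ : ℝ, 0 < δ → δ ≤ δ₀ → ∀ᶠ x : ℕ in atTop,
          (#(pairFamily f i δ c x) : ℝ) ≤ ε * (x : ℝ) / Real.log x ^ k) :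
    ∀ (k : ℕ) (f : Fin k → ℤ[X]), IsBatemanHornSystem f →
      ∀ i : Fin k, (f i).natDegree = 2 → UniformTypeI (f i) → CoordLayerThin f i := by
  intro k f hf i hi hT ε hε
  obtain ⟨c, hc0, hc4, H⟩ := hsieve k f hf i hi hT
  obtain ⟨δ₀, hδ₀, Hδ⟩ := H (ε / 2) (half_pos hε)
  have hδpos : 0 < min δ₀ (1 / 4) := lt_min hδ₀ (by norm_num)
  refine ⟨min δ₀ (1 / 4), hδpos, min_le_right _ _, ?_⟩
  filter_upwards [hdict k f hf i hi (min δ₀ (1 / 4)) c hδpos (min_le_right _ _) hc0 hc4,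
    Hδ (min δ₀ (1 / 4)) hδpos (min_le_left _ _),
    (tendsto_mul_div_log_pow_atTop (half_pos hε) k).eventually_ge_atTop 2] with x h1 h2 h3
  have h1' : (coordLayer f i (min δ₀ (1 / 4)) x : ℝ) ≤ 2 + (#(pairFamily f i (min δ₀ (1 / 4)) c x) : ℝ) := by
    exact_mod_cast h1
  have : (coordLayer f i (min δ₀ (1 / 4)) x : ℝ) ≤
      ε / 2 * x / Real.log x ^ k + ε / 2 * x / Real.log x ^ k := by linarith
  calc (coordLayer f i (min δ₀ (1 / 4)) x : ℝ)
      ≤ ε / 2 * x / Real.log x ^ k + ε / 2 * x / Real.log x ^ k := this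
    _ = ε * x / Real.log x ^ k := by ring

/-! ### Glue (proved): union bound over coordinates, `k = 0` -/

/-- Abstract union bound. [folklore] -/
theorem card_le_card_add_sum_card {k : ℕ} (S A : Finset ℕ) (B : Fin k → Finset ℕ)
    (h : S ⊆ A ∪ Finset.univ.biUnion B) : #S ≤ #A + ∑ i, #(B i) :=
  calc #S ≤ #(A ∪ Finset.univ.biUnion B) := card_le_card h
    _ ≤ #A + #(Finset.univ.biUnion B) := card_union_le _ _
    _ ≤ #A + ∑ i, #(B i) := by gcongr; exact card_biUnion_le

/-- **The crux's count is at most (jointly rough ∧ all values prime) + ∑ᵢ E_{f,i}.** [folklore] -/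
theorem card_cruxFilter_le {k : ℕ} (f : Fin k → ℤ[X]) (δ : ℝ) (x : ℕ) :
    #((Icc 1 x).filter (fun n : ℕ => ∀ i, 0 < (f i).eval (n : ℤ) ∧
        ∀ p ∈ range ⌈(x : ℝ) ^ (((f i).natDegree : ℝ) * (1 - δ) / 2)⌉₊,
          p.Prime → ¬ ((p : ℤ) ∣ (f i).eval (n : ℤ)))) ≤
      #((Icc 1 x).filter (fun n : ℕ => (∀ i, 0 < (f i).eval (n : ℤ) ∧
        ∀ p ∈ range ⌈(x : ℝ) ^ (((f i).natDegree : ℝ) * (1 - δ) / 2)⌉₊,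
          p.Prime → ¬ ((p : ℤ) ∣ (f i).eval (n : ℤ))) ∧ ∀ i, ((f i).eval (n : ℤ)).toNat.Prime)) +
      ∑ i, coordLayer f i δ x := by
  unfold coordLayer
  refine card_le_card_add_sum_card _ _ _ fun n hn => ?_
  rw [mem_filter] at hn
  by_cases hall : ∀ i, ((f i).eval (n : ℤ)).toNat.Prime
  · exact mem_union.mpr (Or.inl (mem_filter.mpr ⟨hn.1, hn.2, hall⟩))
  · push Not at hall
    obtain ⟨i, hi⟩ := hall
    exact mem_union.mpr (Or.inr (mem_biUnion.mpr ⟨i, mem_univ i, mem_filter.mpr ⟨hn.1, hn.2, hi⟩⟩))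

/-- Jointly rough with all values prime `⇒` counted by `polyPrimeCount`. [folklore] -/
theorem card_filter_allPrime_le_polyPrimeCount {k : ℕ} (f : Fin k → ℤ[X]) (δ : ℝ) (x : ℕ) :
    #((Icc 1 x).filter (fun n : ℕ => (∀ i, 0 < (f i).eval (n : ℤ) ∧
        ∀ p ∈ range ⌈(x : ℝ) ^ (((f i).natDegree : ℝ) * (1 - δ) / 2)⌉₊,
          p.Prime → ¬ ((p : ℤ) ∣ (f i).eval (n : ℤ))) ∧ ∀ i, ((f i).eval (n : ℤ)).toNat.Prime)) ≤
      polyPrimeCount f x := by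
  unfold polyPrimeCount
  refine card_le_card fun n hn => ?_
  simp only [mem_filter, mem_Icc] at hn
  simp only [mem_filter, mem_range]
  exact ⟨by omega, fun i => ⟨(hn.2.1 i).1, hn.2.2 i⟩⟩

/-! ### The composition: the stubs imply the crux BY NAME -/

/-- **The crux's statement from the seven stub STATEMENTS** (hypothesis form; real proof, no `sorry`,
axioms ⊆ {propext, Classical.choice, Quot.sound}).  The conclusion is the crux's body verbatim (so that
the by-name audit sees exactly one theorem concluding `BalancedSemiprimeLayer`, the next one).  Proof:
reduce to `k ≥ 1` (`Negative.balancedSemiprimeLayer_iff_pos`), get `CoordLayerThin f i` for every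
coordinate by degree (`natDegree ≥ 1`: `Negative.natDegree_pos_of_isBatemanHornSystem`; `= 1`: linear
stub; `= 2`: lever → uniform Type-I → dictionary + sieve; `≥ 3`: residual stub) with `ε/k`, take
`δ = minᵢ δᵢ` (monotonicity stub), and add up (`card_cruxFilter_le`,
`card_filter_allPrime_le_polyPrimeCount`). [folklore] -/
theorem balancedSemiprimeLayer_of_parts
    (hmono : ∀ (k : ℕ) (f : Fin k → ℤ[X]) (i : Fin k) (δ₁ δ₂ : ℝ), δ₁ ≤ δ₂ →
      ∀ x : ℕ, coordLayer f i δ₁ x ≤ coordLayer f i δ₂ x)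
    (hlin : ∀ (k : ℕ) (f : Fin k → ℤ[X]), IsBatemanHornSystem f →
      ∀ i : Fin k, (f i).natDegree = 1 → CoordLayerThin f i)
    (hHoo : ∀ g : ℤ[X], g.natDegree = 2 → Irreducible g →
      TwistedHooleyDilates (discrim (g.coeff 2) (g.coeff 1) (g.coeff 0)))
    (hT1 : ∀ g : ℤ[X], g.natDegree = 2 → Irreducible g →
      TwistedHooleyDilates (discrim (g.coeff 2) (g.coeff 1) (g.coeff 0)) → UniformTypeI g)
    (hdict : ∀ (k : ℕ) (f : Fin k → ℤ[X]), IsBatemanHornSystem f → ∀ i : Fin k, (f i).natDegree = 2 →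
      ∀ δ c : ℝ, 0 < δ → δ ≤ 1 / 4 → 0 < c → c ≤ 1 / 4 →
        ∀ᶠ x : ℕ in atTop, coordLayer f i δ x ≤ 2 + #(pairFamily f i δ c x))
    (hsieve : ∀ (k : ℕ) (f : Fin k → ℤ[X]), IsBatemanHornSystem f → ∀ i : Fin k, (f i).natDegree = 2 →
      UniformTypeI (f i) → ∃ c : ℝ, 0 < c ∧ c ≤ 1 / 4 ∧ ∀ ε : ℝ, 0 < ε → ∃ δ₀ : ℝ, 0 < δ₀ ∧
        ∀ δ : ℝ, 0 < δ → δ ≤ δ₀ → ∀ᶠ x : ℕ in atTop,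
          (#(pairFamily f i δ c x) : ℝ) ≤ ε * (x : ℝ) / Real.log x ^ k)
    (hhigh : ∀ (k : ℕ) (f : Fin k → ℤ[X]), IsBatemanHornSystem f →
      ∀ i : Fin k, 3 ≤ (f i).natDegree → CoordLayerThin f i) :
    ∀ (k : ℕ) (f : Fin k → ℤ[X]), IsBatemanHornSystem f → ∀ ε : ℝ, 0 < ε →
      ∃ δ : ℝ, 0 < δ ∧ δ ≤ 1 / 4 ∧ ∀ᶠ x : ℕ in atTop,
        (((Icc 1 x).filter (fun n : ℕ => ∀ i, 0 < (f i).eval (n : ℤ) ∧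
            ∀ p ∈ range ⌈(x : ℝ) ^ (((f i).natDegree : ℝ) * (1 - δ) / 2)⌉₊,
              p.Prime → ¬ ((p : ℤ) ∣ (f i).eval (n : ℤ)))).card : ℝ) ≤
          (polyPrimeCount f x : ℝ) + ε * (x : ℝ) / Real.log x ^ k := by
  show BalancedSemiprimeLayer
  rw [balancedSemiprimeLayer_iff_pos]
  intro k f hk hf ε hε
  have hquad := coordLayerThin_quadratic_of_parts hdict hsieve
  -- every coordinate has a thin layer
  have hthin : ∀ i : Fin k, CoordLayerThin f i := by
    intro i
    have hpos := natDegree_pos_of_isBatemanHornSystem hf i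
    rcases Nat.lt_trichotomy (f i).natDegree 2 with hlt | heq | hgt
    · exact hlin k f hf i (by omega)
    · exact hquad k f hf i heq
        (hT1 (f i) heq (hf.irreducible i) (hHoo (f i) heq (hf.irreducible i)))
    · exact hhigh k f hf i (by omega)
  have hk' : (0 : ℝ) < k := by exact_mod_cast hk
  choose δ hδpos hδle hδev using fun i => hthin i (ε / k) (div_pos hε hk')
  have hne : (Finset.univ : Finset (Fin k)).Nonempty := ⟨⟨0, hk⟩, mem_univ _⟩
  set δ₀ : ℝ := Finset.univ.inf' hne δ with hδ₀
  have hδ₀le : ∀ i, δ₀ ≤ δ i := fun i => Finset.inf'_le δ (mem_univ i)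
  refine ⟨δ₀, (Finset.lt_inf'_iff hne).mpr fun i _ => hδpos i,
    (hδ₀le ⟨0, hk⟩).trans (hδle _), ?_⟩
  have hall : ∀ᶠ x : ℕ in atTop, ∀ i, (coordLayer f i (δ i) x : ℝ) ≤ ε / k * (x : ℝ) / Real.log x ^ k :=
    eventually_all.mpr hδev
  filter_upwards [hall] with x hx
  have h1 := card_cruxFilter_le f δ₀ x
  have h2 : ∀ i, coordLayer f i δ₀ x ≤ coordLayer f i (δ i) x :=
    fun i => hmono k f i δ₀ (δ i) (hδ₀le i) x
  have h3 := card_filter_allPrime_le_polyPrimeCount f δ₀ x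
  have h1' : (#((Icc 1 x).filter (fun n : ℕ => ∀ i, 0 < (f i).eval (n : ℤ) ∧
        ∀ p ∈ range ⌈(x : ℝ) ^ (((f i).natDegree : ℝ) * (1 - δ₀) / 2)⌉₊,
          p.Prime → ¬ ((p : ℤ) ∣ (f i).eval (n : ℤ)))) : ℝ) ≤
      (polyPrimeCount f x : ℝ) + ∑ i, (coordLayer f i (δ i) x : ℝ) := by
    have h4 : #((Icc 1 x).filter (fun n : ℕ => ∀ i, 0 < (f i).eval (n : ℤ) ∧
        ∀ p ∈ range ⌈(x : ℝ) ^ (((f i).natDegree : ℝ) * (1 - δ₀) / 2)⌉₊,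
          p.Prime → ¬ ((p : ℤ) ∣ (f i).eval (n : ℤ)))) ≤
        polyPrimeCount f x + ∑ i, coordLayer f i (δ i) x :=
      h1.trans (add_le_add h3 (sum_le_sum fun i _ => h2 i))
    exact_mod_cast h4
  refine h1'.trans ?_
  have hsum : ∑ i : Fin k, (coordLayer f i (δ i) x : ℝ) ≤ ∑ _i : Fin k, ε / k * (x : ℝ) / Real.log x ^ k :=
    sum_le_sum fun i _ => hx i
  have hconst : ∑ _i : Fin k, ε / k * (x : ℝ) / Real.log x ^ k = ε * (x : ℝ) / Real.log x ^ k := by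
    rw [sum_const, card_univ, Fintype.card_fin, nsmul_eq_mul]
    rw [← mul_div_assoc]
    congr 1
    field_simp
  linarith

/-- **The line concludes the crux BY NAME** (the `#h21_check_skeleton` theorem): the seven registered
stubs, fed to `balancedSemiprimeLayer_of_parts`, give
`Summit.Parity.BatemanHorn.Theses.RoughValueTransport.BalancedSemiprimeLayer`.  No `sorry` of its own;
its axiom closure contains `sorryAx` exactly through the `stub_*`. -/
theorem BalancedSemiprimeLayer_of : BalancedSemiprimeLayer :=
  balancedSemiprimeLayer_of_parts stub_coordLayerMono stub_linearLayer stub_twistedHooley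
    stub_uniformTypeI stub_quadraticDictionary stub_quadraticSieve stub_higherLayer

/-! ### The line's reach without the open residual: every system of degree `≤ 2` -/

/-- **The crux's conclusion for EVERY Bateman–Horn system all of whose coordinates have degree `≤ 2`**
(k-tuple / twin / Sophie Germain systems, `X² + 1` and all Hardy–Littlewood quadratic systems, mixed
systems such as `(X, X²+X+1)`), from the stubs OTHER than `stub_higherLayer` — i.e. unconditional as
of now (all of them have landed) — UNCONDITIONAL.  Same proof as
`balancedSemiprimeLayer_of_parts`, the degree trichotomy never reaching `≥ 3`. [folklore] -/
theorem layerConclusion_of_natDegree_le_two :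
    ∀ (k : ℕ) (f : Fin k → ℤ[X]), IsBatemanHornSystem f → (∀ i, (f i).natDegree ≤ 2) →
      ∀ ε : ℝ, 0 < ε → ∃ δ : ℝ, 0 < δ ∧ δ ≤ 1 / 4 ∧ ∀ᶠ x : ℕ in atTop,
        (((Icc 1 x).filter (fun n : ℕ => ∀ i, 0 < (f i).eval (n : ℤ) ∧
            ∀ p ∈ range ⌈(x : ℝ) ^ (((f i).natDegree : ℝ) * (1 - δ) / 2)⌉₊,
              p.Prime → ¬ ((p : ℤ) ∣ (f i).eval (n : ℤ)))).card : ℝ) ≤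
          (polyPrimeCount f x : ℝ) + ε * (x : ℝ) / Real.log x ^ k := by
  intro k f hf hdeg ε hε
  rcases Nat.eq_zero_or_pos k with hk0 | hk
  · -- `k = 0`: the proved `k = 0` slice of the crux
    subst hk0
    refine ⟨1 / 4, by norm_num, le_rfl, Eventually.of_forall fun x => ?_⟩
    have h1 : #((Icc 1 x).filter (fun n : ℕ => ∀ i : Fin 0, 0 < (f i).eval (n : ℤ) ∧
        ∀ p ∈ range ⌈(x : ℝ) ^ (((f i).natDegree : ℝ) * (1 - 1 / 4) / 2)⌉₊,
          p.Prime → ¬ ((p : ℤ) ∣ (f i).eval (n : ℤ)))) ≤ x := by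
      calc _ ≤ (Icc 1 x).card := card_filter_le _ _
        _ = x := by simp
    have h2 : polyPrimeCount f x = x + 1 := by
      unfold polyPrimeCount
      rw [Finset.filter_true_of_mem (fun n _ => fun i => i.elim0), Finset.card_range]
    have h1' : (#((Icc 1 x).filter (fun n : ℕ => ∀ i : Fin 0, 0 < (f i).eval (n : ℤ) ∧
        ∀ p ∈ range ⌈(x : ℝ) ^ (((f i).natDegree : ℝ) * (1 - 1 / 4) / 2)⌉₊,
          p.Prime → ¬ ((p : ℤ) ∣ (f i).eval (n : ℤ)))) : ℝ) ≤ x := by exact_mod_cast h1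
    have h3 : (0 : ℝ) ≤ ε * x / Real.log x ^ 0 := by positivity
    rw [h2]; push_cast; linarith
  have hquad := coordLayerThin_quadratic_of_parts stub_quadraticDictionary stub_quadraticSieve
  have hthin : ∀ i : Fin k, CoordLayerThin f i := by
    intro i
    have hpos := natDegree_pos_of_isBatemanHornSystem hf i
    rcases Nat.lt_or_ge (f i).natDegree 2 with hlt | hge
    · exact stub_linearLayer k f hf i (by omega)
    · have heq : (f i).natDegree = 2 := le_antisymm (hdeg i) hge
      exact hquad k f hf i heq
        (stub_uniformTypeI (f i) heq (hf.irreducible i) (stub_twistedHooley (f i) heq (hf.irreducible i)))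
  have hk' : (0 : ℝ) < k := by exact_mod_cast hk
  choose δ hδpos hδle hδev using fun i => hthin i (ε / k) (div_pos hε hk')
  have hne : (Finset.univ : Finset (Fin k)).Nonempty := ⟨⟨0, hk⟩, mem_univ _⟩
  set δ₀ : ℝ := Finset.univ.inf' hne δ with hδ₀
  have hδ₀le : ∀ i, δ₀ ≤ δ i := fun i => Finset.inf'_le δ (mem_univ i)
  refine ⟨δ₀, (Finset.lt_inf'_iff hne).mpr fun i _ => hδpos i,
    (hδ₀le ⟨0, hk⟩).trans (hδle _), ?_⟩
  have hall : ∀ᶠ x : ℕ in atTop, ∀ i, (coordLayer f i (δ i) x : ℝ) ≤ ε / k * (x : ℝ) / Real.log x ^ k :=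
    eventually_all.mpr hδev
  filter_upwards [hall] with x hx
  have h1 := card_cruxFilter_le f δ₀ x
  have h2 : ∀ i, coordLayer f i δ₀ x ≤ coordLayer f i (δ i) x :=
    fun i => coordLayer_mono f i (hδ₀le i) x
  have h3 := card_filter_allPrime_le_polyPrimeCount f δ₀ x
  have h1' : (#((Icc 1 x).filter (fun n : ℕ => ∀ i, 0 < (f i).eval (n : ℤ) ∧
        ∀ p ∈ range ⌈(x : ℝ) ^ (((f i).natDegree : ℝ) * (1 - δ₀) / 2)⌉₊,
          p.Prime → ¬ ((p : ℤ) ∣ (f i).eval (n : ℤ)))) : ℝ) ≤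
      (polyPrimeCount f x : ℝ) + ∑ i, (coordLayer f i (δ i) x : ℝ) := by
    have h4 : #((Icc 1 x).filter (fun n : ℕ => ∀ i, 0 < (f i).eval (n : ℤ) ∧
        ∀ p ∈ range ⌈(x : ℝ) ^ (((f i).natDegree : ℝ) * (1 - δ₀) / 2)⌉₊,
          p.Prime → ¬ ((p : ℤ) ∣ (f i).eval (n : ℤ)))) ≤
        polyPrimeCount f x + ∑ i, coordLayer f i (δ i) x :=
      h1.trans (add_le_add h3 (sum_le_sum fun i _ => h2 i))
    exact_mod_cast h4
  refine h1'.trans ?_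
  have hsum : ∑ i : Fin k, (coordLayer f i (δ i) x : ℝ) ≤ ∑ _i : Fin k, ε / k * (x : ℝ) / Real.log x ^ k :=
    sum_le_sum fun i _ => hx i
  have hconst : ∑ _i : Fin k, ε / k * (x : ℝ) / Real.log x ^ k = ε * (x : ℝ) / Real.log x ^ k := by
    rw [sum_const, card_univ, Fintype.card_fin, nsmul_eq_mul]
    rw [← mul_div_assoc]
    congr 1
    field_simp
  linarith

end Summit.Parity.BatemanHorn.Cruxes.BalancedSemiprimeLayer.SmoothModulusTwistedHooley
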